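import Mathlib.GroupTheory.PresentedGroup
import Mathlib.Algebra.BigOperators.Fin
import Mathlib.Tactic
import Summits.ABC.FunctionField.TransferSheet
import Literature.NumberTheory.DiophantineGeometry.GenEllThm21With
import HarnessLib
import HarnessLib.Audit

/-!
# Cell abc-ff — transfer sheet, chain (b) BOGOMOLOV / PARSHIN: the group-theoretic core of
# Bogomolov's proof (the «12» PROVED over Mathlib) and the typed currency of Parshin's implication

`Summits/ABC/FunctionField/TransferSheetBMY.lean` (cell abc-ff; mathematics and Lean by the cell's BMY
lens seat abc-ff-lens-2, `HOME/lens-2/Sketch_BMY.lean` + `BMY-STEPS.md`, farm rc 0; landed by the typer).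
HONESTY: abc is not proved by any of this; every `def … : Prop` tagged `@[conjecture]` below is a
REQUIREMENT-shaped statement used only as a hypothesis (D-0139/D-0140); typed ≠ proved; a primary is a
source, not an endorsement.

## Chain (b-α): Bogomolov's topological proof of geometric Szpiro (rows B-1…B-5)
Amorós–Bogomolov–Katzarkov–Pantev 2000, §5 (Lemma 5.1, Cor. 5.5); Zhang 2001; Mochizuki 2016
«Bogomolov's proof of the geometric version of the Szpiro conjecture from the point of view of
inter-universal Teichmüller theory», §§1–3. For a SEMISTABLE non-isotrivial elliptic fibration over a
base of genus `q` with `m` singular fibres `I_{kᵢ}` (so `N = deg 𝔇_min = Σ kᵢ`), the global monodromy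
relation in `π₁` lifts to the universal central extension `B₃ = ⟨σ₁, σ₂ | σ₁σ₂σ₁ = σ₂σ₁σ₂⟩ ≅ S̃L₂(ℤ)` of
`SL₂(ℤ)` as `∏ⱼ [α̃ⱼ, β̃ⱼ] · ∏ᵢ g̃ᵢ σ₁^{kᵢ} g̃ᵢ⁻¹ = t_c^n`, `t_c = (σ₁σ₂)⁶` central, `n = deg φ_*ω`.
* B-3 («the 12», PROVED here: `Bogomolov.abkpDegree_holds`): the abelianisation `χ : B₃ → ℤ`,
  `χ(σᵢ) = 1`, `χ(t_c) = 12`, gives `Σ kᵢ = 12 n` — the same `12` as Noether's `deg 𝔇 = 12 deg ω`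
  (row KS-1) and as `Pic(M̄₁,₁) = ℤ/12`.
* B-4 («the 2», crude; `Bogomolov.AbkpCrude`, typed ≠ proved): `2 n < m + 2 q` — the centre moves the
  line of rays by a full turn, each positive parabolic lift by less than half a turn (exponent-blind),
  Milnor–Wood for commutators.
* B-5 (sharp, `Bogomolov.AbkpSharp`, typed ≠ proved): `2 n + 2 ≤ 2 q + m` after finite-index
  amplification, i.e. `N ≤ 6 (2q − 2 + m)` with NO `ε` (`Bogomolov.szpiro_bookkeeping`).
First non-transferring steps (rows B-2 ∧ B-4): `G_ℚ` has no one-relator presentation tying the local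
inertia images to genus data, and there is no conjugation-invariant «length» with a uniform per-place
bound on (a central extension of) the image of `ρ_E : G_ℚ → GL₂(ℤ̂)` (BKP 2002 §6(iv): «no direct analogs
of the ℤ-central extension … we do not yet understand what the local inequalities should be»).
* Row CF-4 (`R_B` sharp) is a NEGATIVE row and is NOT typed as a requirement: any arithmetic structure
  reproducing B-3/B-4/B-5 verbatim for all semistable `E/ℚ` outputs `|Δ_min| ≤ C · N^6`, which is FALSE
  (`verbatim_bogomolov_transfer_false` below = the tree's
  `Literature.Barriers.ABC.SzpiroEpsilonCannotBeDroppedSemistable_holds`, Masser 1990).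
* Row CF-5 (`R_B` with a defect `K`) as a bare `∃`-interface over an unnamed carrier group is implied by
  POLY-SZPIRO(K) itself (take `Γ = ℝ`) — vacuous-by-interface, hence NOT typed (plan ruling); a typed
  version needs a CONSTRUCTED receptacle (tree: dormant route `Summit.ABC.ABC.Theses.CongruentialReceptacle`;
  barrier candidate: Burger–Monod, no non-trivial quasimorphisms on higher-rank lattices).

## Chain (b-β): BMY / canonical-class inequality ⇒ Parshin (rows P-0…P-4, CF-6)
The arithmetic Bogomolov–Miyaoka–Yau inequality itself (`R_P`: Parshin's three-constant form
`ω̂² ≤ a₂ Σ_y δ_y log N y + a₁ (2g−2) log|D_F| + a₀(g) [F:ℚ]`, Lang, *Number Theory III*, Ch. VII §2;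
the naive one-constant form is REFUTED in genus 2 by Bost–Mestre–Moret-Bailly 1990) is NOT typable over
Mathlib (no arithmetic surfaces / Arakelov intersection numbers; a record of free real fields would be
vacuous). What IS typed is its CONSEQUENCE CURRENCY after Parshin's covering construction and the
Belyi–Frey transfer: Vojta's height inequality on `ℙ¹ ∖ {0, 1, ∞}` in bounded degree with a
multiplicative loss `Λ` — the tree's `GenEll.VojtaP1DegWith d Λ` — as `ParshinHeightConsequence Λ`, with
the tree's PROVED transfers to `GenEll.ABCWithExponent Λ` and, at `Λ = 1`, to `ABC`; and the bridge to
the sheet's currency `PolyAbcWith`. STRENGTH: fixed absolute constants give `Λ > 1` («NOT abc —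
POLY-abc(Λ) ⇒ POLY-SZPIRO» only for `Λ < 6/5`, Silverman's elimination); `Λ = 1` is Vojta's conjecture
(⟺ abc, restatement class). PATH: none from fixed constants. (Lens-2's census texts c-3/c-4.)
-/

noncomputable section

namespace Summit.ABC.FunctionField

namespace Bogomolov

/-! ## The braid group `B₃ = S̃L₂(ℤ)` and the degree `χ` (rows B-1/B-3) -/

/-- The braid relator `σ₁σ₂σ₁(σ₂σ₁σ₂)⁻¹` in the free group on two letters (ABKP 2000, Lemma 5.1).
[folklore] -/
def braidRel : FreeGroup (Fin 2) :=
  FreeGroup.of 0 * FreeGroup.of 1 * FreeGroup.of 0 *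
    (FreeGroup.of 1 * FreeGroup.of 0 * FreeGroup.of 1)⁻¹

/-- `B₃ = ⟨σ₁, σ₂ | σ₁σ₂σ₁ = σ₂σ₁σ₂⟩` (Mathlib's `PresentedGroup`), which is `S̃L₂(ℤ) = Map₁,₁`
(ABKP 2000, Lemma 5.1: `t_a ↦ σ₁`, `t_b ↦ σ₂`). [folklore] -/
abbrev B3 : Type := PresentedGroup ({braidRel} : Set (FreeGroup (Fin 2)))

/-- `σ₁ = t_a` (lift of the Dehn twist `T = (1 1; 0 1)`). [folklore] -/
def σ₁ : B3 := PresentedGroup.of (rels := ({braidRel} : Set (FreeGroup (Fin 2)))) 0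

/-- `σ₂ = t_b`. [folklore] -/
def σ₂ : B3 := PresentedGroup.of (rels := ({braidRel} : Set (FreeGroup (Fin 2)))) 1

/-- `t_c = (t_a t_b)⁶`: generates `ker(B₃ → SL₂(ℤ)) ≅ ℤ` (`(t_a t_b)³` is central and maps to `−1`);
on the universal cover of the circle of rays it is the translation by one full turn (ABKP 2000,
Lemma 5.1). [folklore] -/
def tc : B3 := (σ₁ * σ₂) ^ 6

/-- The lifted global monodromy relation of a semistable elliptic fibration (rows B-2/B-3): base genus
`q`, `m` singular fibres of types `I_{k i}` (`k i ≥ 1`, positivity = holomorphicity), `n = deg φ_*ω`: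
`∏ⱼ [αⱼ, βⱼ] · ∏ᵢ gᵢ σ₁^{kᵢ} gᵢ⁻¹ = t_c ^ n` in `B₃` (ABKP 2000, §5.3, proof of Cor. 5.5; Mochizuki 2016,
§2). The fields are elements of the concrete group `B3` — an inhabited interface, not a free record.
[folklore] -/
structure AbkpRelation (q m n : ℕ) where
  /-- lifts of the `a`-cycle monodromies of the base -/
  α : Fin q → B3
  /-- lifts of the `b`-cycle monodromies of the base -/
  β : Fin q → B3
  /-- conjugators placing each cusp monodromy in standard position -/
  g : Fin m → B3
  /-- number of components of the fibre `I_{k i}` -/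
  k : Fin m → ℕ
  /-- every singular fibre is of type `I_k` with `k ≥ 1` -/
  k_pos : ∀ i, 0 < k i
  /-- the lifted global relation -/
  rel : (List.ofFn fun j => α j * β j * (α j)⁻¹ * (β j)⁻¹).prod *
      (List.ofFn fun i => g i * σ₁ ^ (k i) * (g i)⁻¹).prod = tc ^ n

/-- **Row B-3 («the 12»)**: `Σ kᵢ = 12 · n` for every lifted relation (ABKP 2000, Cor. 5.5, first
assertion). A function-field THEOREM, PROVED below over the presentation (`abkpDegree_holds`).
[folklore] -/
def AbkpDegree : Prop :=
  ∀ (q m n : ℕ) (R : AbkpRelation q m n), (∑ i, R.k i) = 12 * n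

/-- **Row B-4 («the 2», crude form)**: if `n > 0` then `2 · n < m + 2 · q`. For `q = 0` this is ABKP
2000, Cor. 5.5 (`m > 2n`: the centre `t_c^n` translates the line of rays by `−2πn`, each
positive-parabolic minimal lift by an amount in `(−π, 0]` whatever its exponent `kᵢ`); for `q > 0` each
commutator contributes `< 2π` (Milnor–Wood; Zhang 2001, Lemmas 3.5–3.7 as reported by Mochizuki 2016
§3 (B1)–(B3)). THIS IS LENS-2's GROUP-THEORETIC TRANSCRIPTION of a theorem printed for fibrations —
typed ≠ proved; recorded `@[conjecture]` (open in the tree), used only as a hypothesis of the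
bookkeeping lemma below. [folklore] -/
@[conjecture] def AbkpCrude : Prop :=
  ∀ (q m n : ℕ) (_R : AbkpRelation q m n), 0 < n → 2 * n < m + 2 * q

/-- **Row B-5 (sharp form, after finite-index amplification)**: if `n > 0` then `2 · n + 2 ≤ 2 · q + m`,
i.e. `N = 12 n ≤ 6 (2q − 2 + m)` with NO epsilon and NO additive constant — the geometric Szpiro
inequality for semistable families over a base of genus `q` (Zhang 2001; Mochizuki 2016 §3, last
display `Σ vᵢ ≤ 6(2g − 2 + r)`). As a bare statement about `B₃` it is lens-2's assembly of `AbkpCrude`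
over all finite-index subgroups of the punctured-surface group (`m′ + 2q′ = 2 + d (2q − 2 + m)`,
`n′ = d n`, `d → ∞`) — typed ≠ proved; `@[conjecture]` (open in the tree), hypothesis only. [folklore] -/
@[conjecture] def AbkpSharp : Prop :=
  ∀ (q m n : ℕ) (_R : AbkpRelation q m n), 0 < n → 2 * n + 2 ≤ 2 * q + m

/-- **Bookkeeping «6 = 12 / 2» as chain (b) uses it (row B-5 ⇒ geometric Szpiro):** from `Σ kᵢ = 12 n`
(B-3) and `2n + 2 ≤ 2q + m` (B-5) one gets `Σ kᵢ + 12 ≤ 6 · (2q + m)`, i.e. `N ≤ 6 (2q − 2 + m)`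
(stated additively over `ℕ`). PROVED (arithmetic). [folklore] -/
theorem szpiro_bookkeeping (hdeg : AbkpDegree) (hsharp : AbkpSharp)
    {q m n : ℕ} (R : AbkpRelation q m n) (hn : 0 < n) :
    (∑ i, R.k i) + 12 ≤ 6 * (2 * q + m) := by
  have h1 := hdeg q m n R
  have h2 := hsharp q m n R hn
  omega

/-! ## Kernel proof of row B-3: the abelianisation `χ : B₃ → ℤ` -/

/-- `χ : B₃ →* Multiplicative ℤ`, `σ₁, σ₂ ↦ 1` — well defined because the braid relator has exponent
sum `0` (ABKP 2000, Lemma 5.1: `χ(t_a) = χ(t_b) = 1`, `χ(t_c) = 12`). [folklore] -/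
def chi : B3 →* Multiplicative ℤ :=
  PresentedGroup.toGroup (f := fun _ : Fin 2 => Multiplicative.ofAdd (1 : ℤ)) (by
    intro r hr
    rw [Set.mem_singleton_iff] at hr
    subst hr
    simp only [braidRel, map_mul, map_inv, FreeGroup.lift_apply_of]
    group)

/-- The integer degree `deg x = χ(x) ∈ ℤ`. [folklore] -/
def deg (x : B3) : ℤ := Multiplicative.toAdd (chi x)

/-- `deg` is additive. [folklore] -/
theorem deg_mul (x y : B3) : deg (x * y) = deg x + deg y := by
  simp only [deg, map_mul, toAdd_mul]

/-- `deg 1 = 0`. [folklore] -/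
theorem deg_one : deg 1 = 0 := by
  simp only [deg, map_one, toAdd_one]

/-- `deg x⁻¹ = − deg x`. [folklore] -/
theorem deg_inv (x : B3) : deg x⁻¹ = -deg x := by
  simp only [deg, map_inv, toAdd_inv]

/-- `deg (x ^ k) = k · deg x`. [folklore] -/
theorem deg_pow (x : B3) (k : ℕ) : deg (x ^ k) = k * deg x := by
  simp only [deg, map_pow, toAdd_pow, nsmul_eq_mul]

/-- `deg σ₁ = 1`. [folklore] -/
theorem deg_σ₁ : deg σ₁ = 1 := by
  simp only [deg, chi, σ₁, PresentedGroup.toGroup.of, toAdd_ofAdd]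

/-- `deg σ₂ = 1`. [folklore] -/
theorem deg_σ₂ : deg σ₂ = 1 := by
  simp only [deg, chi, σ₂, PresentedGroup.toGroup.of, toAdd_ofAdd]

/-- **`χ(t_c) = 12` — «the 12»** (ABKP 2000, Lemma 5.1). [folklore] -/
theorem deg_tc : deg tc = 12 := by
  simp only [tc, deg_pow, deg_mul, deg_σ₁, deg_σ₂]
  norm_num

/-- `deg (t_c ^ n) = 12 n`. [folklore] -/
theorem deg_tc_pow (n : ℕ) : deg (tc ^ n) = 12 * (n : ℤ) := by
  rw [deg_pow, deg_tc]; ring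

/-- Commutators have degree `0`. [folklore] -/
theorem deg_comm (a b : B3) : deg (a * b * a⁻¹ * b⁻¹) = 0 := by
  simp only [deg_mul, deg_inv]; abel

/-- A cusp term `g σ₁^k g⁻¹` has degree `k`. [folklore] -/
theorem deg_conj_pow (g : B3) (k : ℕ) : deg (g * σ₁ ^ k * g⁻¹) = k := by
  simp only [deg_mul, deg_inv, deg_pow, deg_σ₁]; ring

/-- `deg` of a product of a list. [folklore] -/
theorem deg_list_prod (l : List B3) : deg l.prod = (l.map deg).sum := by
  induction l with
  | nil => simp [deg_one]
  | cons a l ih => simp [deg_mul, ih]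

/-- **Row B-3 is a theorem over Mathlib: `Σ kᵢ = 12 n`** for every lifted monodromy relation in `B₃`
(ABKP 2000, Cor. 5.5, first assertion) — apply `deg`: commutators have degree `0`, each cusp term
`gᵢ σ₁^{kᵢ} gᵢ⁻¹` has degree `kᵢ`, and `t_c^n` has degree `12 n`. PROVED (lens-2). [folklore] -/
theorem abkpDegree_holds : AbkpDegree := by
  intro q m n R
  have h := congrArg deg R.rel
  rw [deg_mul, deg_list_prod, deg_list_prod, deg_tc_pow] at h
  simp only [List.map_ofFn, List.sum_ofFn, Function.comp_def, deg_comm, deg_conj_pow,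
    Finset.sum_const_zero, zero_add] at h
  exact_mod_cast h

end Bogomolov

/-! ## Row CF-4: the verbatim arithmetic transfer of Bogomolov's argument is FALSE -/

/-- **Row CF-4 (negative row, kernel): any arithmetic structure reproducing rows B-3/B-4/B-5 verbatim for
all semistable `E/ℚ` would give `|Δ_min(E)| ≤ C · N_E^6` with an absolute `C` — and that is FALSE**
(even with a polylog loss): the tree's PROVED barrier
`Literature.Barriers.ABC.SzpiroEpsilonCannotBeDroppedSemistable_holds` (Masser 1990: Frey curves of
balanced abc triples, semistable with `N = rad(abc)`). So chain (b)'s replacement must pay an `ε` (or a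
fixed loss `K > 6`), exactly like chains (a) and (c). [cite: Masser1990, Theorem] -/
theorem verbatim_bogomolov_transfer_false :
    ¬ ∃ C : ℝ, ∀ (W : WeierstrassCurve ℚ) [W.IsElliptic], W.IsSemistable ℤ →
      (W.minimalDiscriminantNorm ℤ : ℝ) ≤ C * (W.conductorNorm ℤ : ℝ) ^ 6 := by
  rintro ⟨C, hC⟩
  refine Literature.Barriers.ABC.SzpiroEpsilonCannotBeDroppedSemistable_holds ⟨C, 0, fun W _ hW => ?_⟩
  simpa [Real.rpow_zero] using hC W hW

/-! ## Row CF-6: the typed consequence currency of Parshin's «arithmetic BMY ⇒ height conjecture» -/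

open Literature.NumberTheory.DiophantineGeometry
open Literature.NumberTheory.DiophantineGeometry.GenEll

/-- **Row CF-6 consequence currency — `ParshinHeightConsequence Λ`.** What Parshin's arithmetic BMY
(Lang's three-constant form, or the conductor-radical CC2 form) is FOR, after Parshin's ramified
covering construction / Vojta 1988 and the Belyi–Frey transfer: Vojta's height inequality on
`ℙ¹ ∖ {0,1,∞}` for algebraic points of degree `≤ d` with a MULTIPLICATIVE LOSS `Λ ≥ 1` — the tree's
`GenEll.VojtaP1DegWith d Λ` — for every `d`. For FIXED absolute BMY constants the derived `Λ` is `> 1`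
(the loss sits in the construction): «NOT abc — POLY-abc(Λ)», rung A-PS, EFFECTIVE iff the constants
are; `Λ = 1` is Vojta's conjecture itself (⟺ abc, rung A0) and is NOT derivable from fixed constants.
The inequality `R_P` itself is NOT typed (no Arakelov intersection theory in the tree) — wording,
barriers and falsifiers in the cell's `lens-2/BMY-STEPS.md` §3. CONJECTURAL REQUIREMENT (lens-2), used
only as a hypothesis; D-0139/D-0140. [folklore] -/
@[conjecture] def ParshinHeightConsequence (Λ : ℝ) : Prop :=
  ∀ d : ℕ, 0 < d → VojtaP1DegWith d Λ

/-- **Skeleton CF-6 (A-PS direction), sorry-free:** the consequence currency with loss `Λ` gives abc with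
exponent `Λ` (`GenEll.ABCWithExponent Λ`: every exponent `> Λ`) — the tree's PROVED
`GenEll.abcExp_of_vojtaP1DegWith`. For `Λ > 1`: «NOT abc — POLY-abc(Λ)». [folklore] -/
theorem abcWithExponent_of_parshinHeightConsequence {Λ : ℝ} (h : ParshinHeightConsequence Λ) :
    ABCWithExponent Λ :=
  abcExp_of_vojtaP1DegWith h

/-- Bridge to the sheet's currency: `GenEll.ABCWithExponent Λ` (`Λ > 0`) gives `PolyAbcWith M` for every
`M > Λ` (take `ε = M/Λ − 1`). [folklore] -/
theorem polyAbcWith_of_abcWithExponent {Λ M : ℝ} (hΛ : 0 < Λ) (h : ABCWithExponent Λ) (hM : Λ < M) :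
    PolyAbcWith M := by
  obtain ⟨C, -, hC⟩ := h (M / Λ - 1) (by rw [sub_pos, one_lt_div hΛ]; exact hM)
  refine ⟨C, fun a b c habc => ?_⟩
  have hΛM : Λ * (1 + (M / Λ - 1)) = M := by field_simp; ring
  have := hC a b c habc
  rw [hΛM] at this
  exact this.le

/-- **Skeleton CF-6 in the sheet's currency:** `ParshinHeightConsequence Λ` (`Λ > 0`) ⟹ `PolyAbcWith M`
for every `M > Λ`. «NOT abc — POLY-abc(M)» for `Λ ≥ 1` fixed. [folklore] -/
theorem polyAbcWith_of_parshinHeightConsequence {Λ M : ℝ} (hΛ : 0 < Λ)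
    (h : ParshinHeightConsequence Λ) (hM : Λ < M) : PolyAbcWith M :=
  polyAbcWith_of_abcWithExponent hΛ (abcWithExponent_of_parshinHeightConsequence h) hM

/-- **Skeleton CF-6 (A0 endpoint), sorry-free:** at `Λ = 1` the consequence currency IS Vojta's
conjecture for `ℙ¹ ∖ {0,1,∞}` in bounded degree (`GenEll.vojtaP1DegWith_one_iff`), which gives the summit
sentence `ABC` by the tree's PROVED `GenEll.abc_of_vojtaP1Deg`. This certifies only the SHAPE
«Λ = 1 ⇒ A0»; `Λ = 1` is abc-strength (restatement class), not a consequence of any fixed-constant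
arithmetic BMY. abc is NOT proved by this. [folklore] -/
theorem abc_of_parshinHeightConsequence_one (h : ParshinHeightConsequence 1) : _root_.ABC := by
  have h' : ∀ d : ℕ, 0 < d → VojtaP1Deg d := fun d hd => (vojtaP1DegWith_one_iff d).1 (h d hd)
  exact abc_of_vojtaP1Deg h'

end Summit.ABC.FunctionField

end
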